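import Summits.QuantumFields.BalabanUV.T4Continuum.Support.NE7TorusChartDecoding
import Summits.QuantumFields.BalabanUV.T4Continuum.Support.NE7EtaMinimiserGaugeCovariance
import Summits.QuantumFields.BalabanUV.T4Continuum.Support.BlockAveragePushDirGauge
import HarnessLib

/-!
# NE7MultiplierAnnihilatesGaugeDirections — THE DERIVATIVE OF THE CONSTRAINED MINIMAL ACTION IN THE DATUM (THE LAGRANGE MULTIPLIER OF THE BORDERED HESSIAN) VANISHES ON THE
# COVARIANT GAUGE DIRECTIONS AT EVERY UNITARY PERIODIC DATUM: `D(minAct_{j+1} ∘ chart_{V₀})(0)[skewPR (res (gaugeDir V₀ λ))] = 0` for every `N`-periodic `𝔲(n)`-valued `λ`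
# (ROAD-G116 §6 (G3): in the multiplier term `Dm(0)[D²𝒢(0)[X,X]]` the FRAME ∕ GAUGE components of `D²𝒢` are free)

Cell `pub-balaban`, rung (B)+1 sub-cell t4, lineage `b2b-balaban-t4-ne7b-p1` (row NE7b OWNER + CRUX PROVER; junction service for row NE7, ruling R-OWNER-149-1 (2)), generation 161.
Index `t4/b2b-balaban-t4-ne7b-p1/g161/INDEX.md`; memo `g161/records/SCOPING-G3.md`.
WHY.  In the bordered Hessian of ✓ p828683 (`NE7MinActHessianLagrangianAllData`) the multiplier is `Dm(0)`, `m = minAct_{j+1} ∘ chart_{V₀}`; the linearised multi-level average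
`levelQ′` splits into a straight (double-bar) tower plus a COARSE GAUGE DIRECTION at the top datum (row NE3's structure theorem `D_U Z = Q̄_U Z + gaugeDir_{Ů}(F_U Z)`), and only the
straight part is ℓ¹-contracting.  THIS FILE: the gauge part costs nothing, because `m` is invariant under coarse gauge transformations of the datum, hence `Dm(0)` annihilates the
tangent of the gauge orbit through `V₀` read in the exponential chart — at EVERY unitary periodic datum (critical or not, small or not; if `m` is not differentiable at `0` the
`fderiv` is `0` by convention and the identity holds trivially).
WHAT ([folklore]; 0 def, 0 sorry; every `d`, every `U(n)`, `L ≥ 1`, `ε ≥ 0`, multi-level class smallness `LevelSmall d L j (ε∕(L^{j+1})²)` of row NE3):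
* §1 `minAct_gaugeAct_corner` — **THE CONSTRAINED MINIMAL ACTION IS INVARIANT UNDER COARSE GAUGE TRANSFORMATIONS OF THE DATUM**: for a unitary `N`-periodic site field `g` on the
  unit lattice, `minAct (sfClass d L N ε) L N (j+1) (V^{g}) = minAct (sfClass d L N ε) L N (j+1) V` — the blockwise-constant fine gauge `u(x) = g(⌊x∕L^{j+1}⌋)` exchanges the two
  admissible sets (✓ `NE7EtaMinimiserGaugeCovariance.mem_admissible_gaugeAct_datum`, B7 (45)) and preserves the level action (✓ `levelAction_gaugeAct`); an identity of infima, NO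
  minimiser is needed.
* §2 `hasDerivAt_skewPR_resDir_gaugeRelLog` — the chart coordinate `y(t) = skewPR N (relLog N V₀ (V₀^{e^{tλ}}))` of the gauge orbit is differentiable at `t = 0` with derivative
  `skewPR N (resDir N (gaugeDir V₀ λ))` (✓ `BlockAveragePushDirGauge.hasDerivAt_gaugeRelLog`); `eventually_chart_coord_gaugeAct` — near `t = 0`, `chart_{V₀}(y(t)) = V₀^{e^{tλ}}`
  (✓ `NE7TorusChartDecoding.chart_skewPR_relLog_eq`).
* §3 **`fderiv_minAct_chart_gaugeDir_eq_zero`** — the displayed identity.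
HONEST FRAMING (page 1): a symmetry identity over landed kernel theorems (B7 (8)∕(45) gauge covariance of the average, B11 (5) invariance of the Wilson action); nothing of Bałaban's
asserted; OUR `minAct` (B11 (8) minimisers with `sfClass`, an honest infimum); NOT NE7 as a spine node, NOT NE3; row NE7b NOT PRINTED ∕ NOT PROVED; spine 0∕9; finite T⁴ rung (B)+1 — NOT
infinite volume, NOT mass gap, NOT BetaPertH, NOT Clay.
-/

set_option autoImplicit false

open scoped BigOperators Matrix Matrix.Norms.L2Operator Topology
open NormedSpace Finset Set Filter Metric

namespace Summit.QuantumFields.BalabanUV.T4Continuum.NE7MultiplierAnnihilatesGaugeDirections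

open Literature.MathematicalPhysics.QuantumFieldTheory.Balaban1983to89
open B7Prop1Explicit B7Prop2Explicit MatrixLog UnitaryModel
open T4AveragingDeficitWall (IsUnitaryCfg SmallField)
open T4AveragingDeficitWallBoundary (IsPeriodicCfg)
open AveragingDeficitTorusChart (TDir chart chart_zero resDir)
open AveragingDeficitChartCalculus (relLog)
open AveragingDeficitTwoLevelPrep (skewSub skewPR)
open AveragingDeficitMultiLevelPrep (LevelSmall)
open AveragingDeficitKDatum (gaugeAct_inv_gaugeAct)
open MinimalActionLevels (levelAction)
open MinimalActionSandwich (minAct admissible)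
open MinimalActionRate (sfClass)
open NE3EnergyShapes (IsUnitarySite IsPeriodicSite)
open NE7EtaMinimiserGaugeCovariance (levelAction_gaugeAct mem_admissible_gaugeAct_datum isUnitarySite_inv isPeriodicSite_inv)
open NE7TorusChartDecoding (chart_skewPR_relLog_eq)
open BlockAveragePushDirGauge (gaugeDir expGauge gaugeRelLog hasDerivAt_gaugeRelLog hasDerivAt_relUnit_gauge expGauge_zero gaugeAct_const_one
  isPeriodicCfg_gaugeAct_expGauge)
open AveragingDeficitKDatum (isUnitaryCfg_gaugeAct)

noncomputable section

variable {d : ℕ} {n : Type*} [Fintype n] [DecidableEq n]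

/-! ## §1 Coarse gauge invariance of the constrained minimal action -/

/-- The blockwise-constant fine lift `u(x) = g(⌊x∕M⌋)` (componentwise integer division) of a site field `g` has corner values `u(M·w) = g(w)` (`M ≠ 0`). [folklore] -/
theorem cornerLift_corner {M : ℤ} (hM : M ≠ 0) (g : Site d → (Matrix n n ℂ)ˣ) :
    (fun w : Site d => (fun x : Site d => g (fun i => x i / M)) (M • w)) = g := by
  funext w
  simp only
  congr 1
  funext i
  simp only [Pi.smul_apply, smul_eq_mul]
  exact Int.mul_ediv_cancel_left _ hM

/-- The blockwise-constant fine lift of an `N`-periodic site field is `(N·M)`-periodic (`M ≠ 0`). [folklore] -/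
theorem cornerLift_periodic {M : ℤ} (hM : M ≠ 0) {N : ℤ} {g : Site d → (Matrix n n ℂ)ˣ} (hg : IsPeriodicSite g N) :
    IsPeriodicSite (fun x : Site d => g (fun i => x i / M)) (N * M) := by
  intro x i
  simp only
  have e : (fun k => (x + (N * M) • e i) k / M) = (fun k => x k / M) + N • e i := by
    funext k
    simp only [Pi.add_apply, Pi.smul_apply, smul_eq_mul]
    rw [show N * M * e i k = N * e i k * M by ring, Int.add_mul_ediv_right _ _ hM]
  rw [e]
  exact hg _ i

/-- **THE CONSTRAINED MINIMAL ACTION IS INVARIANT UNDER COARSE GAUGE TRANSFORMATIONS OF THE DATUM**: for `L ≥ 1`, `ε ≥ 0`, the class smallness `LevelSmall d L j (ε∕(L^{j+1})²)`, and a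
unitary `N`-periodic site field `g` on the unit lattice, `minAct (sfClass d L N ε) L N (j+1) (V^{g}) = minAct (sfClass d L N ε) L N (j+1) V` — the blockwise-constant fine gauge
`u(x) = g(⌊x∕L^{j+1}⌋)` maps `admissible … V` onto `admissible … V^{g}` (its inverse maps back) with the same level actions, so the two infima coincide. [folklore] -/
theorem minAct_gaugeAct_corner [Nonempty n] {L N : ℕ} (hL : 1 ≤ L) {ε : ℝ} (hε : 0 ≤ ε) (j : ℕ)
    (hs : LevelSmall d L j (ε / ((L : ℝ) ^ (j + 1)) ^ 2)) (V : Site d → Fin d → (Matrix n n ℂ)ˣ)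
    {g : Site d → (Matrix n n ℂ)ˣ} (hg : IsUnitarySite g) (hgP : IsPeriodicSite g (N : ℤ)) :
    minAct d (sfClass d L N ε) L N (j + 1) (gaugeAct g V) = minAct d (sfClass d L N ε) L N (j + 1) V := by
  have hM : ((L : ℤ) ^ (j + 1)) ≠ 0 := pow_ne_zero _ (by exact_mod_cast (show L ≠ 0 by omega))
  -- the fine lift and its inverse
  set u : Site d → (Matrix n n ℂ)ˣ := fun x : Site d => g (fun i => x i / ((L : ℤ) ^ (j + 1))) with hu
  have huu : IsUnitarySite u := fun x => hg _
  have huP : IsPeriodicSite u ((N * L ^ (j + 1) : ℕ) : ℤ) := by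
    have h := cornerLift_periodic (n := n) hM (N := (N : ℤ)) hgP
    have e : ((N * L ^ (j + 1) : ℕ) : ℤ) = (N : ℤ) * (L : ℤ) ^ (j + 1) := by push_cast; ring
    rw [e]; exact h
  have hcorner : (fun w : Site d => u (((L : ℤ) ^ (j + 1)) • w)) = g := cornerLift_corner hM g
  have hui : IsUnitarySite fun z => (u z)⁻¹ := isUnitarySite_inv huu
  have huiP : IsPeriodicSite (fun z => (u z)⁻¹) ((N * L ^ (j + 1) : ℕ) : ℤ) := isPeriodicSite_inv huP
  have hcorner' : (fun w : Site d => (fun z => (u z)⁻¹) (((L : ℤ) ^ (j + 1)) • w)) = fun w => (g w)⁻¹ := by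
    funext w
    show (u (((L : ℤ) ^ (j + 1)) • w))⁻¹ = (g w)⁻¹
    rw [show u (((L : ℤ) ^ (j + 1)) • w) = g w from congrFun hcorner w]
  -- the two images of the level action coincide
  unfold minAct
  congr 1
  ext a
  constructor
  · rintro ⟨U', hU', rfl⟩
    have hback := mem_admissible_gaugeAct_datum hL hε j hs hU' hui huiP
    rw [hcorner', gaugeAct_inv_gaugeAct] at hback
    exact ⟨_, hback, levelAction_gaugeAct L N (j + 1) _ U'⟩
  · rintro ⟨U, hU, rfl⟩
    have hfwd := mem_admissible_gaugeAct_datum hL hε j hs hU huu huP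
    rw [hcorner] at hfwd
    exact ⟨_, hfwd, levelAction_gaugeAct L N (j + 1) u U⟩

/-! ## §2 The gauge orbit through the datum, read in the exponential chart -/

/-- `e^{tλ(x)}` is unitary for `𝔲(n)`-valued `λ`. [folklore] -/
theorem expGauge_isUnitarySite [Nonempty n] {lam : Site d → Matrix n n ℂ} (hlam : ∀ x, lam x ∈ skewAdjoint (Matrix n n ℂ)) (t : ℝ) :
    IsUnitarySite (expGauge lam t) := by
  intro x
  letI : NormedAlgebra ℚ (Matrix n n ℂ) := NormedAlgebra.restrictScalars ℚ ℝ (Matrix n n ℂ)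
  have hskew : (t : ℂ) • lam x ∈ skewAdjoint (Matrix n n ℂ) := by
    rw [Complex.coe_smul]
    exact skewAdjoint.smul_mem t (hlam x)
  rw [mem_unitaryUnits]
  exact NormedSpace.exp_mem_unitary_of_mem_skewAdjoint hskew

/-- The relative logarithm on the torus bonds IS the restriction of `gaugeRelLog`: `relLog N V₀ (V₀^{e^{tλ}}) = resDir N (gaugeRelLog V₀ λ t)`. [folklore] -/
theorem relLog_gaugeAct_expGauge (N : ℕ) (V₀ : Site d → Fin d → (Matrix n n ℂ)ˣ) (lam : Site d → Matrix n n ℂ) (t : ℝ) :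
    relLog N V₀ (gaugeAct (expGauge lam t) V₀) = resDir N (gaugeRelLog V₀ lam t) := rfl

/-- **The chart coordinate of the gauge orbit is differentiable at `t = 0` with derivative the (projected, restricted) gauge direction**:
`d/dt|₀ skewPR N (relLog N V₀ (V₀^{e^{tλ}})) = skewPR N (resDir N (gaugeDir V₀ λ))`. [folklore] -/
theorem hasDerivAt_skewPR_resDir_gaugeRelLog (N : ℕ) [NeZero N] (V₀ : Site d → Fin d → (Matrix n n ℂ)ˣ) (lam : Site d → Matrix n n ℂ) :
    HasDerivAt (fun t : ℝ => skewPR (d := d) (n := n) N (relLog N V₀ (gaugeAct (expGauge lam t) V₀)))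
      (skewPR (d := d) (n := n) N (resDir N (gaugeDir V₀ lam))) 0 := by
  have hres : HasDerivAt (fun t : ℝ => resDir (n := n) N (gaugeRelLog V₀ lam t)) (resDir N (gaugeDir V₀ lam)) 0 := by
    refine hasDerivAt_pi.mpr fun r => hasDerivAt_pi.mpr fun κ => ?_
    exact hasDerivAt_gaugeRelLog V₀ lam (boxVec N r) κ
  exact (skewPR (d := d) (n := n) N).hasFDerivAt.comp_hasDerivAt (0 : ℝ) hres

/-- Near `t = 0` every relative unit `V₀(b)⁻¹ V₀^{e^{tλ}}(b)` on the torus bonds is within `1∕4` of `1` (finitely many representatives, continuity in `t`). [folklore] -/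
theorem eventually_relUnit_gauge_le_quarter {N : ℕ} [NeZero N] (V₀ : Site d → Fin d → (Matrix n n ℂ)ˣ) (lam : Site d → Matrix n n ℂ) :
    ∀ᶠ t in 𝓝 (0 : ℝ), ∀ (r : Fin d → Fin N) (κ : Fin d),
      ‖(((V₀ (boxVec N r) κ)⁻¹ : (Matrix n n ℂ)ˣ) : Matrix n n ℂ) * ((gaugeAct (expGauge lam t) V₀ (boxVec N r) κ : (Matrix n n ℂ)ˣ) : Matrix n n ℂ) - 1‖ ≤ 1 / 4 := by
  have hfin : ∀ᶠ t in 𝓝 (0 : ℝ), ∀ rκ : (Fin d → Fin N) × Fin d,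
      ‖(((V₀ (boxVec N rκ.1) rκ.2)⁻¹ : (Matrix n n ℂ)ˣ) : Matrix n n ℂ)
          * ((gaugeAct (expGauge lam t) V₀ (boxVec N rκ.1) rκ.2 : (Matrix n n ℂ)ˣ) : Matrix n n ℂ) - 1‖ ≤ 1 / 4 := by
    refine Filter.eventually_all.mpr fun rκ => ?_
    have hc : ContinuousAt (fun t : ℝ => ‖(((V₀ (boxVec N rκ.1) rκ.2)⁻¹ : (Matrix n n ℂ)ˣ) : Matrix n n ℂ)
        * ((gaugeAct (expGauge lam t) V₀ (boxVec N rκ.1) rκ.2 : (Matrix n n ℂ)ˣ) : Matrix n n ℂ) - 1‖) 0 :=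
      ((hasDerivAt_relUnit_gauge V₀ lam (boxVec N rκ.1) rκ.2).continuousAt.sub continuousAt_const).norm
    have h0 : ‖(((V₀ (boxVec N rκ.1) rκ.2)⁻¹ : (Matrix n n ℂ)ˣ) : Matrix n n ℂ)
        * ((gaugeAct (expGauge lam 0) V₀ (boxVec N rκ.1) rκ.2 : (Matrix n n ℂ)ˣ) : Matrix n n ℂ) - 1‖ < 1 / 4 := by
      rw [expGauge_zero, gaugeAct_const_one, Units.inv_mul, sub_self, norm_zero]; norm_num
    exact (hc.eventually (gt_mem_nhds h0)).mono fun t ht => ht.le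
  exact hfin.mono fun t ht r κ => ht (r, κ)

/-- **Near `t = 0` the chart point of the orbit coordinate IS the gauge-transformed datum**: for unitary `N`-periodic `V₀` and `𝔲(n)`-valued `N`-periodic `λ`,
`chart_{V₀}(skewPR N (relLog N V₀ (V₀^{e^{tλ}}))) = V₀^{e^{tλ}}` eventually (✓ `chart_skewPR_relLog_eq`). [folklore] -/
theorem eventually_chart_coord_gaugeAct [Nonempty n] {N : ℕ} [NeZero N] {V₀ : Site d → Fin d → (Matrix n n ℂ)ˣ} (hV₀u : IsUnitaryCfg V₀) (hV₀P : IsPeriodicCfg V₀ (N : ℤ))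
    {lam : Site d → Matrix n n ℂ} (hlam : ∀ x, lam x ∈ skewAdjoint (Matrix n n ℂ)) (hlamP : ∀ (x : Site d) (i : Fin d), lam (x + (N : ℤ) • e i) = lam x) :
    ∀ᶠ t in 𝓝 (0 : ℝ),
      chart (ContinuousLinearMap.id ℝ (Matrix n n ℂ)) N V₀ ((skewPR N (relLog N V₀ (gaugeAct (expGauge lam t) V₀)) : ↥(skewSub d n N)) : TDir d n N)
        = gaugeAct (expGauge lam t) V₀ := by
  refine (eventually_relUnit_gauge_le_quarter (N := N) V₀ lam).mono fun t ht => ?_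
  exact chart_skewPR_relLog_eq hV₀u (isUnitaryCfg_gaugeAct (expGauge_isUnitarySite hlam t) hV₀u) hV₀P
    (isPeriodicCfg_gaugeAct_expGauge hV₀P hlamP t) ht

/-! ## §3 The multiplier annihilates the gauge directions -/

/-- **THE LAGRANGE MULTIPLIER ANNIHILATES THE COVARIANT GAUGE DIRECTIONS** (see the module docstring): for every `d`, `U(n)`, `L ≥ 1`, `ε ≥ 0`, the class smallness
`LevelSmall d L j (ε∕(L^{j+1})²)`, every unitary `N`-periodic datum `V₀` and every `𝔲(n)`-valued `N`-periodic site field `λ`,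
`D(minAct (sfClass d L N ε) L N (j+1) ∘ chart_{V₀})(0)[skewPR N (resDir N (gaugeDir V₀ λ))] = 0`. [folklore] -/
theorem fderiv_minAct_chart_gaugeDir_eq_zero [Nonempty n] {L N : ℕ} [NeZero N] (hL : 1 ≤ L) {ε : ℝ} (hε : 0 ≤ ε) (j : ℕ)
    (hs : LevelSmall d L j (ε / ((L : ℝ) ^ (j + 1)) ^ 2)) {V₀ : Site d → Fin d → (Matrix n n ℂ)ˣ}
    (hV₀u : IsUnitaryCfg V₀) (hV₀P : IsPeriodicCfg V₀ (N : ℤ)) {lam : Site d → Matrix n n ℂ}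
    (hlam : ∀ x, lam x ∈ skewAdjoint (Matrix n n ℂ)) (hlamP : ∀ (x : Site d) (i : Fin d), lam (x + (N : ℤ) • e i) = lam x) :
    fderiv ℝ (fun y : ↥(skewSub d n N) =>
        minAct d (sfClass d L N ε) L N (j + 1) (chart (ContinuousLinearMap.id ℝ (Matrix n n ℂ)) N V₀ (y : TDir d n N))) 0
      (skewPR N (resDir N (gaugeDir V₀ lam))) = 0 := by
  set m : ↥(skewSub d n N) → ℝ := fun y =>
    minAct d (sfClass d L N ε) L N (j + 1) (chart (ContinuousLinearMap.id ℝ (Matrix n n ℂ)) N V₀ (y : TDir d n N)) with hm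
  set y : ℝ → ↥(skewSub d n N) := fun t => skewPR (d := d) (n := n) N (relLog N V₀ (gaugeAct (expGauge lam t) V₀)) with hy
  -- the orbit coordinate: value and derivative at `0`
  have hy0 : y 0 = 0 := by
    simp only [hy, expGauge_zero, gaugeAct_const_one, AveragingDeficitChartCalculus.relLog_self, map_zero]
  have hyd : HasDerivAt y (skewPR (d := d) (n := n) N (resDir N (gaugeDir V₀ lam))) 0 := hasDerivAt_skewPR_resDir_gaugeRelLog N V₀ lam
  -- `m ∘ y` is eventually constant `= m 0`
  have hconst : (fun t : ℝ => m (y t)) =ᶠ[𝓝 0] fun _ => m 0 := by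
    refine (eventually_chart_coord_gaugeAct hV₀u hV₀P hlam hlamP).mono fun t ht => ?_
    simp only [hm, hy]
    rw [ht, ZeroMemClass.coe_zero, chart_zero]
    exact minAct_gaugeAct_corner hL hε j hs V₀ (expGauge_isUnitarySite hlam t)
      (fun x i => by simp only [expGauge, hlamP x i])
  have hzero : HasDerivAt (fun t : ℝ => m (y t)) 0 0 := (hasDerivAt_const (0 : ℝ) (m 0)).congr_of_eventuallyEq hconst
  by_cases hdiff : DifferentiableAt ℝ m 0
  · have hchain : HasDerivAt (fun t : ℝ => m (y t)) (fderiv ℝ m 0 (skewPR (d := d) (n := n) N (resDir N (gaugeDir V₀ lam)))) 0 := by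
      have h : HasFDerivAt m (fderiv ℝ m 0) (y 0) := by rw [hy0]; exact hdiff.hasFDerivAt
      exact h.comp_hasDerivAt (0 : ℝ) hyd
    exact hchain.unique hzero
  · rw [fderiv_zero_of_not_differentiableAt hdiff]
    rfl

end

end Summit.QuantumFields.BalabanUV.T4Continuum.NE7MultiplierAnnihilatesGaugeDirections
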